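import Summits.RiemannHypothesis.RiemannHypothesis.Theses.WeilGroundState
import Summits.RiemannHypothesis.RiemannHypothesis.Theorems.WeilGroundStateGroundStateSimpleEvenStubTransfer
import Summits.RiemannHypothesis.RiemannHypothesis.Theorems.WeilGroundStateGroundStateSimpleEvenStubZeroSideLever
import Summits.RiemannHypothesis.RiemannHypothesis.Theorems.WeilGroundStateGroundStateSimpleEvenStubLeverClosure
import Literature.NumberTheory.LFunctions.WeilWindowSuzukiProofs
import HarnessLib

/-!
# Crux `GroundStateSimpleEven` (stmt-RiemannHypothesis-1526) — skeleton of line `Sketch`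
# (idea `primitive-transfer-zero-gap`), lead prover-line-stmt-RiemannHypothesis-1526-0

The crux is `∀ a > 0, WeilWindowSimpleEven a` (`Iff.rfl`): for every window the bottom `ε(a)` of
Weil's form is simple, isolated, even — variationally, odd normalised test functions and even ones
orthogonal to a witness `φ` lie `≥ ε(a) + δ`.

Composition (`GroundStateSimpleEven_of`):
* witness `φ = 1`: an odd test function, and an even one with `∫ conj 1 · g = 0`, are MEAN-ZERO, so the
  window clause follows from a gap for mean-zero normalised test functions
  (`stub_weilWindowSimpleEven_of_meanZeroGap`, LANDED p96449,
  `Theorems/WeilGroundStateGroundStateSimpleEvenStubTransfer.lean`);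
* `0 < a ≤ 1/100`: the mean-zero gap `δ = 1/10` is in the tree
  (`weilGroundEnergy_add_le_of_integral_eq_zero`, Suzuki 2026 Thm 1.4 in variational form);
* `1/100 < a`: the mean-zero gap is `stub_meanZeroGap_of_hundredth_lt` — the remainder of the crux,
  the only open stub.

The line's mechanism for the remainder (card §Lever), LANDED as supports: a mean-zero window test
function is a derivative `g = h'` (`ConnesVanSuijlekom.exists_primitive`, `w = 0`); in the RH world
`Re Q(h') ≥ γ₁² Re Q(h)` (`stub_re_weilQuadratic_deriv_ge`, p96651,
`…StubZeroSideLever.lean`), and lever + second-moment localisation of near-null mean-zero states ⇒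
mean-zero gap (`stub_meanZeroGap_of_lever_of_localised`, p96598, `…StubLeverClosure.lean`, RH-free as
stated). Their composition `meanZeroGap_of_RH_of_localised` below records exactly what the line proves
toward the remainder: CONDITIONAL on RH, on `0 < ε(a)`, and on the localisation hypothesis.
-/

noncomputable section

open Set MeasureTheory Filter
open scoped Real Topology ComplexConjugate

namespace Summit.RiemannHypothesis.RiemannHypothesis.Theorems

open Literature.NumberTheory.LFunctions

set_option linter.dupNamespace false in
/-- **Small windows (in the tree).** For `0 < a ≤ 1/100` the window clause holds with `φ = 1`,
`δ = 1/10` (`weilGroundEnergy_add_le_of_integral_eq_zero`, the variational Suzuki 2026 Thm 1.4),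
through the landed transfer stub. -/
theorem weilWindowSimpleEven_of_le_hundredth {a : ℝ} (ha : 0 < a) (ha' : a ≤ 1 / 100) :
    WeilWindowSimpleEven a :=
  stub_weilWindowSimpleEven_of_meanZeroGap a (1 / 10) (by norm_num)
    fun _ hg hsupp hnorm hmean ↦ weilGroundEnergy_add_le_of_integral_eq_zero hg ha ha' hsupp hnorm hmean

set_option linter.dupNamespace false in
/-- **What the line proves toward the remainder (conditional).** In the RH world, at a window with
`ε(a) > 0`, a zero-free height `γ₁` (no zero of `ζ` with `0 < Im s < γ₁`) and a second-moment
localisation of `θ`-near-null derivatives (`‖h'‖₂² ≤ Λ‖h‖₂²`, `Λ < γ₁²`), mean-zero normalised test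
functions lie `≥ ε(a) + δ` — composition of the two landed stubs (lever p96651, closure p96598). -/
theorem meanZeroGap_of_RH_of_localised (hRH : RiemannHypothesis) {a γ₁ Λ θ : ℝ}
    (hε : 0 < weilGroundEnergy a) (hγ₁ : 0 < γ₁)
    (hfree : ∀ s : ℂ, riemannZeta s = 0 → 0 < s.im → γ₁ ≤ s.im)
    (hΛ : 0 < Λ) (hΛγ : Λ < γ₁ ^ 2) (hθ : 0 < θ)
    (hloc : ∀ h : ℝ → ℂ, IsWeilTest h → tsupport h ⊆ Icc (-a) a →
      (weilQuadratic (deriv h)).re ≤ (weilGroundEnergy a + θ) * ∫ t, ‖deriv h t‖ ^ 2 →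
        ∫ t, ‖deriv h t‖ ^ 2 ≤ Λ * ∫ t, ‖h t‖ ^ 2) :
    ∃ δ : ℝ, 0 < δ ∧ ∀ g : ℝ → ℂ, IsWeilTest g → tsupport g ⊆ Icc (-a) a →
      ∫ t, ‖g t‖ ^ 2 = (1 : ℝ) → ∫ t, g t = 0 → weilGroundEnergy a + δ ≤ (weilQuadratic g).re :=
  stub_meanZeroGap_of_lever_of_localised hε hΛ hΛγ hθ
    (fun _ hh _ ↦ stub_re_weilQuadratic_deriv_ge hRH hγ₁ hfree hh) hloc

set_option linter.dupNamespace false in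
/-- **STUB M (the remainder of the crux: mean-zero gap beyond Suzuki's windows).** For every window
`a > 1/100` there is `δ > 0` such that every `L²`-normalised MEAN-ZERO test function on `[-a, a]` has
`Re Q(g) ≥ ε(a) + δ`. Equivalent (given the transfer) to the crux at `a` together with "the ground state
is not orthogonal to the constants". The line reaches it only conditionally
(`meanZeroGap_of_RH_of_localised`); unconditionally nothing in the line's `Leans on` supplies it
(NOTES.md `## Tail obstruction`; BarrierNotes-r1-k1 B1–B2). -/
theorem stub_meanZeroGap_of_hundredth_lt (a : ℝ) (ha : 1 / 100 < a) :
    ∃ δ : ℝ, 0 < δ ∧ ∀ g : ℝ → ℂ, IsWeilTest g → tsupport g ⊆ Icc (-a) a →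
      ∫ t, ‖g t‖ ^ 2 = (1 : ℝ) → ∫ t, g t = 0 → weilGroundEnergy a + δ ≤ (weilQuadratic g).re := by
  sorry

set_option linter.dupNamespace false in
/-- **Composition.** The crux `GroundStateSimpleEven` (= `∀ a > 0, WeilWindowSimpleEven a`, `Iff.rfl`)
from the landed transfer stub, the tree's small windows `a ≤ 1/100`, and the remainder stub for
`a > 1/100`. -/
theorem GroundStateSimpleEven_of :
    Summit.RiemannHypothesis.RiemannHypothesis.Theses.WeilGroundState.GroundStateSimpleEven := by
  intro a ha
  by_cases hsmall : a ≤ 1 / 100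
  · exact weilWindowSimpleEven_of_le_hundredth ha hsmall
  · obtain ⟨δ, hδ, hgap⟩ := stub_meanZeroGap_of_hundredth_lt a (lt_of_not_ge hsmall)
    exact stub_weilWindowSimpleEven_of_meanZeroGap a δ hδ hgap

end Summit.RiemannHypothesis.RiemannHypothesis.Theorems

end
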